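import Literature.InformationTheory.QuantumCodes.QuantumReedMullerCodesShortened
import Literature.InformationTheory.QuantumCodes.ErasureErrorDetectionRadius
import HarnessLib

/-!
# The `[[2^m, 2^m − 2m − 2, 4]]` quantum Reed–Muller class: an explicit single-error-correcting, double-error-DETECTING
# (SEC-DED) flag decoder in each sector — the optimum `(t, s) = (1, 1)` at distance `4`

Topic `Literature/InformationTheory/QuantumCodes`, namespace `Literature.InformationTheory.QuantumCodes.QRM` (venture QEC,
LADDER-QEC cell `qec`, PARTITION row 08; «08.SECDED», in the lineage of item 141 «08.QRM»; rung Q4: an explicit decoder as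
a FUNCTION, here with a reject flag). Continues `QuantumReedMullerCodesShortened.lean` (`QRM.extPointDecode`, `emptyRow`,
`coordRow`, `genMatrix_mulVec_single_emptyRow`, `genMatrix_mulVec_single_coordRow`) and the tree's 08.TRS vocabulary
`ErasureErrorDetectionRadius.lean` (`FlagErasureDecoder V Syn = Finset V → Syn → Option (V → 𝔽₂)`, `Succeeds`, `Safe`,
`CorrectsLocatesDetects D syn S t r s` — Gottesman 1997 §2.3 «correct `t`, locate `r`, detect `s` ⇔ `r + s + 2t < d`»).

The members of the quantum Reed–Muller family `QRM(m; a, b)` (`QuantumReedMullerCodes.lean`) with `a ≥ 1` have `X`-checks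
`ℛ(a,m) ⊇ ℛ(1,m)` — the all-ones row and the `m` coordinate rows. For a phase-flip pattern `e` the all-ones check returns the
PARITY of `wt(e)` and the coordinate checks return the SUM of the positions in `supp e` (MacWilliams–Sloane Ch. 1 §7 / Ch. 13 §3:
`ℛ(m−2,m) = ℛ(1,m)^⊥` is the extended Hamming code, «single-error-correcting, double-error-detecting»). The rule: parity `1` ⇒
answer the single error at the point named by the coordinate bits; parity `0` and coordinates `0` ⇒ answer «no error»; parity
`0` and coordinates `≠ 0` ⇒ FLAG (two errors at distinct points `p ≠ q` give coordinates `p + q ≠ 0`).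

* `secdedDecode m r hr : FlagErasureDecoder (Fin m → ZMod 2) (Mono m r → ZMod 2)` (erasures ignored) — (definition);
* ★ `secdedDecode_correctsLocatesDetects_Z` (`a ≥ 1`) / `…_X` (`b ≥ 1`): `CorrectsLocatesDetects … 1 0 1` — every single flip is
  corrected, every pattern of `≤ 2` flips is handled SAFELY (corrected or flagged, never mis-corrected);
* `secded_optimal` (the `a = b = 1` class, `m ≥ 4`, `d = 4`): no flag decoder of either sector achieves `(t, r, s)` with
  `r + s + 2t ≥ 4` (the tree's necessity theorem), so `(1, 0, 1)` — and `(0, 0, 3)`, pure detection of three errors — are the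
  frontier; instance `code_16_6_4_secded`.

0 named facts, no `decide`, no instances/notation; axioms standard. HONEST FRAMING: the textbook SEC-DED rule machine-checked for
the whole class; code-capacity, sector-wise; nothing probabilistic; no novelty.

## References

* [MacWilliamsSloane1977] Ch. 1 §7 (chunk p0030: Hamming syndrome decoding; p0035: the extended Hamming code, dual of ℛ(1,m));
  Ch. 13 §3 Thm. 4 (ℛ(m−2,m) = ℛ(1,m)^⊥, chunks p0308–p0309).
* [Gottesman1997] §2.3 (chunk p0014 L17–26: detect `s` ⇔ `d ≥ s+1`; `r + s + 2t + 1 ≤ d`).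
-/

namespace Literature.InformationTheory.QuantumCodes

open Finset Matrix Literature.InformationTheory.Coding Literature.InformationTheory.Coding.ReedMuller

namespace QRM

variable {m : ℕ}

/-! ### Supports of weight `≤ 2` -/

/-- `supp` is the set counted by the Hamming weight. [folklore] -/
private theorem card_supp_eq_hammingNorm {V : Type*} [Fintype V] [DecidableEq V] (e : V → ZMod 2) :
    (supp e).card = hammingNorm e := by
  unfold supp hammingNorm
  rfl

/-- A binary word is the sum of the unit vectors on its support. [folklore] -/
private theorem eq_sum_single_supp {V : Type*} [Fintype V] [DecidableEq V] (e : V → ZMod 2) :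
    e = ∑ p ∈ supp e, Pi.single p (1 : ZMod 2) := by
  funext v
  rw [Finset.sum_apply]
  have h01 : ∀ a : ZMod 2, a ≠ 0 → a = 1 := by decide
  by_cases hv : e v = 0
  · rw [hv]
    symm
    refine sum_eq_zero fun p hp => ?_
    have hp' : e p ≠ 0 := by unfold supp at hp; exact (mem_filter.1 hp).2
    rw [Pi.single_apply]
    split_ifs with hvp
    · subst hvp; exact absurd hv hp'
    · rfl
  · have hmem : v ∈ supp e := by unfold supp; exact mem_filter.2 ⟨mem_univ _, hv⟩
    rw [sum_eq_single_of_mem v hmem (fun p _ hpv => by rw [Pi.single_eq_of_ne (Ne.symm hpv)])]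
    rw [Pi.single_eq_same]
    exact h01 _ hv

/-- A word of weight exactly `2` is the sum of two distinct unit vectors. [folklore] -/
private theorem exists_pair_of_card_supp_eq_two {V : Type*} [Fintype V] [DecidableEq V] {e : V → ZMod 2}
    (h : (supp e).card = 2) : ∃ p q : V, p ≠ q ∧ e = Pi.single p 1 + Pi.single q 1 := by
  obtain ⟨p, q, hpq, hs⟩ := card_eq_two.1 h
  refine ⟨p, q, hpq, ?_⟩
  rw [eq_sum_single_supp e, hs, sum_pair hpq]

/-! ### The SEC-DED flag decoder -/

/-- **The SEC-DED flag decoder** on the syndrome of the monomial checks of degree `≤ r` (`1 ≤ r`; erasures are ignored):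
parity bit `1` ⇒ the single error at the point whose coordinates are the coordinate-check bits; parity `0` and all coordinate
bits `0` ⇒ no error; parity `0` and some coordinate bit `1` ⇒ FLAG (`none`). (definition)
[cite: MacWilliamsSloane1977, Ch. 1 §7 (chunk p0030) and §9 (p0035: extended Hamming code, double-error detection)] -/
def secdedDecode (m r : ℕ) (hr : 1 ≤ r) : FlagErasureDecoder (Fin m → ZMod 2) (Mono m r → ZMod 2) := fun _ s =>
  if s (emptyRow m r) = 0 then (if (fun i => s (coordRow hr i)) = 0 then some 0 else none)
  else some (Pi.single (fun i => s (coordRow hr i)) 1)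

/-- On the zero syndrome the decoder answers «no error». [cite: MacWilliamsSloane1977, Ch. 1 §7 (chunk p0030)] -/
theorem secdedDecode_zero (m r : ℕ) (hr : 1 ≤ r) (Er : Finset (Fin m → ZMod 2)) :
    secdedDecode m r hr Er 0 = some 0 := by
  unfold secdedDecode
  have h1 : (0 : Mono m r → ZMod 2) (emptyRow m r) = 0 := rfl
  have h2 : (fun i => (0 : Mono m r → ZMod 2) (coordRow hr i)) = 0 := rfl
  rw [if_pos h1, if_pos h2]

/-- On the syndrome of a single error at `p` the decoder answers that error. [cite: MacWilliamsSloane1977, Ch. 1 §7 (chunk p0030)] -/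
theorem secdedDecode_single {r : ℕ} (hr : 1 ≤ r) (Er : Finset (Fin m → ZMod 2)) (p : Fin m → ZMod 2) :
    secdedDecode m r hr Er (genMatrix m r *ᵥ Pi.single p 1) = some (Pi.single p 1) := by
  unfold secdedDecode
  rw [genMatrix_mulVec_single_emptyRow, if_neg one_ne_zero]
  congr 2
  funext i
  exact genMatrix_mulVec_single_coordRow hr p i

/-- On the syndrome of two errors at distinct points the decoder FLAGS (parity `0`, coordinates `p + q ≠ 0`).
[cite: MacWilliamsSloane1977, Ch. 1 §9 (chunk p0035: the extended Hamming code detects double errors)] -/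
theorem secdedDecode_pair {r : ℕ} (hr : 1 ≤ r) (Er : Finset (Fin m → ZMod 2)) {p q : Fin m → ZMod 2} (hpq : p ≠ q) :
    secdedDecode m r hr Er (genMatrix m r *ᵥ (Pi.single p 1 + Pi.single q 1)) = none := by
  unfold secdedDecode
  rw [mulVec_add]
  have hpar : (genMatrix m r *ᵥ Pi.single p 1 + genMatrix m r *ᵥ Pi.single q 1) (emptyRow m r) = 0 := by
    rw [Pi.add_apply, genMatrix_mulVec_single_emptyRow, genMatrix_mulVec_single_emptyRow]
    exact CharTwo.add_self_eq_zero _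
  rw [if_pos hpar, if_neg]
  intro h0
  apply hpq
  funext i
  have := congr_fun h0 i
  rw [Pi.add_apply, genMatrix_mulVec_single_coordRow, genMatrix_mulVec_single_coordRow, Pi.zero_apply] at this
  -- `p i + q i = 0` in characteristic two gives `p i = q i`
  calc p i = p i + q i + q i := by rw [add_assoc, CharTwo.add_self_eq_zero, add_zero]
    _ = q i := by rw [this, zero_add]

/-- **SEC-DED for the checks of degree `≤ r`, `r ≥ 1`** (one error type, check matrix `genMatrix m r`, trivial errors
`S ∋ 0`): the flag decoder corrects every single error and handles every pattern of at most two errors safely.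
[cite: MacWilliamsSloane1977, Ch. 1 §9 (chunk p0035: extended Hamming codes are single-error-correcting double-error-detecting)] [cite: Gottesman1997, §2.3 (chunk p0014 L24-26)] -/
theorem secdedDecode_correctsLocatesDetects {r : ℕ} (hr : 1 ≤ r) (S : Submodule (ZMod 2) ((Fin m → ZMod 2) → ZMod 2)) :
    (secdedDecode m r hr).CorrectsLocatesDetects (fun e => genMatrix m r *ᵥ e)
      (S : Set ((Fin m → ZMod 2) → ZMod 2)) 1 0 1 := by
  classical
  intro Er e hEr
  have hEr0 : Er = ∅ := card_eq_zero.1 (Nat.le_zero.1 hEr)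
  subst hEr0
  simp only [sdiff_empty]
  have hself : ∀ x : (Fin m → ZMod 2) → ZMod 2, x + x = 0 := fun x => funext fun v => CharTwo.add_self_eq_zero _
  -- weight ≤ 1: the decoder returns the error itself
  have hle1 : (supp e).card ≤ 1 → (secdedDecode m r hr) ∅ (genMatrix m r *ᵥ e) = some e := by
    intro h1
    rw [card_supp_eq_hammingNorm] at h1
    rcases eq_zero_or_eq_single_of_hammingNorm_le_one h1 with rfl | ⟨p, rfl⟩
    · rw [mulVec_zero]; exact secdedDecode_zero m r hr ∅
    · exact secdedDecode_single hr ∅ p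
  refine ⟨fun h1 => ⟨e, hle1 h1, by rw [hself]; exact S.zero_mem⟩, fun h2 c hc => ?_⟩
  -- weight ≤ 2: either weight ≤ 1 (answered correctly) or exactly 2 (flagged)
  rcases Nat.lt_or_ge (supp e).card 2 with hlt | hge
  · rw [hle1 (by omega)] at hc
    cases hc
    rw [hself]; exact S.zero_mem
  · obtain ⟨p, q, hpq, rfl⟩ := exists_pair_of_card_supp_eq_two (le_antisymm h2 hge)
    rw [secdedDecode_pair hr ∅ hpq] at hc
    cases hc

/-- ★ **SEC-DED in the `Z` sector of `QRM(m; a, b)`, `a ≥ 1`**: the explicit flag decoder on the `X`-check syndrome corrects every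
single phase flip and detects (flags, never mis-corrects) every double phase flip — `CorrectsLocatesDetects … 1 0 1`.
[cite: MacWilliamsSloane1977, Ch. 1 §9 (chunk p0035)] [cite: Gottesman1997, §2.3 (chunk p0014 L24-26)] -/
theorem secdedDecode_correctsLocatesDetects_Z {a b : ℕ} (h : a + b < m) (ha : 1 ≤ a) :
    (secdedDecode m a ha).CorrectsLocatesDetects (fun e => (code m a b h).HX *ᵥ e)
      ((code m a b h).rowSpZ : Set ((Fin m → ZMod 2) → ZMod 2)) 1 0 1 := by
  rw [code_HX]
  exact secdedDecode_correctsLocatesDetects ha _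

/-- ★ **SEC-DED in the `X` sector of `QRM(m; a, b)`, `b ≥ 1`** (bit flips read on the `Z`-checks `ℛ(b,m)`).
[cite: MacWilliamsSloane1977, Ch. 1 §9 (chunk p0035)] [cite: Gottesman1997, §2.3 (chunk p0014 L24-26)] -/
theorem secdedDecode_correctsLocatesDetects_X {a b : ℕ} (h : a + b < m) (hb : 1 ≤ b) :
    (secdedDecode m b hb).CorrectsLocatesDetects (fun e => (code m a b h).HZ *ᵥ e)
      ((code m a b h).rowSpX : Set ((Fin m → ZMod 2) → ZMod 2)) 1 0 1 := by
  rw [code_HZ]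
  exact secdedDecode_correctsLocatesDetects hb _

/-- ★ **Optimality for the `a = b = 1` class `[[2^m, 2^m − 2m − 2, 4]]` (`m ≥ 4`)**: the explicit decoders achieve `(t, r, s) =
(1, 0, 1)` in both sectors, and NO flag decoder of either sector achieves any `(t, r, s)` with `r + s + 2t ≥ 4` (`d_Z = d_X = 4`).
[cite: Gottesman1997, §2.3 (chunk p0014 L24-26: "must have distance at least r + s + 2t + 1")] -/
theorem secded_optimal (hm : 4 ≤ m) :
    ((secdedDecode m 1 le_rfl).CorrectsLocatesDetects (fun e => (code m 1 1 (by omega)).HX *ᵥ e)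
        ((code m 1 1 (by omega)).rowSpZ : Set ((Fin m → ZMod 2) → ZMod 2)) 1 0 1 ∧
      (secdedDecode m 1 le_rfl).CorrectsLocatesDetects (fun e => (code m 1 1 (by omega)).HZ *ᵥ e)
        ((code m 1 1 (by omega)).rowSpX : Set ((Fin m → ZMod 2) → ZMod 2)) 1 0 1) ∧
    ∀ t r s : ℕ, 4 ≤ r + s + 2 * t →
      (¬ ∃ D : FlagErasureDecoder (Fin m → ZMod 2) (Mono m 1 → ZMod 2),
          D.CorrectsLocatesDetects (fun e => (code m 1 1 (by omega)).HX *ᵥ e)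
            ((code m 1 1 (by omega)).rowSpZ : Set ((Fin m → ZMod 2) → ZMod 2)) t r s) ∧
      (¬ ∃ D : FlagErasureDecoder (Fin m → ZMod 2) (Mono m 1 → ZMod 2),
          D.CorrectsLocatesDetects (fun e => (code m 1 1 (by omega)).HZ *ᵥ e)
            ((code m 1 1 (by omega)).rowSpX : Set ((Fin m → ZMod 2) → ZMod 2)) t r s) := by
  have hk : 0 < (code m 1 1 (by omega)).k := code_k_pos (by omega) (by omega)
  have hdZ : (code m 1 1 (by omega)).dZ = 4 := by rw [code_dZ (by omega) (by omega)]; norm_num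
  have hdX : (code m 1 1 (by omega)).dX = 4 := by rw [code_dX (by omega) (by omega)]; norm_num
  refine ⟨⟨secdedDecode_correctsLocatesDetects_Z _ le_rfl, secdedDecode_correctsLocatesDetects_X _ le_rfl⟩,
    fun t r s hrs => ⟨fun hD => ?_, fun hD => ?_⟩⟩
  · have := ((code m 1 1 (by omega)).exists_correctsLocatesDetectsZ_iff hk t r s).1 hD
    omega
  · have := ((code m 1 1 (by omega)).exists_correctsLocatesDetectsX_iff hk t r s).1 hD
    omega

/-- **`[[16, 6, 4]]`**: the explicit SEC-DED decoders correct every single bit flip / phase flip and flag every double one.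
[cite: MacWilliamsSloane1977, Ch. 1 §9 (chunk p0035)] -/
theorem code_16_6_4_secded :
    (secdedDecode 4 1 le_rfl).CorrectsLocatesDetects (fun e => (code 4 1 1 (by norm_num)).HX *ᵥ e)
        ((code 4 1 1 (by norm_num)).rowSpZ : Set ((Fin 4 → ZMod 2) → ZMod 2)) 1 0 1 ∧
      (secdedDecode 4 1 le_rfl).CorrectsLocatesDetects (fun e => (code 4 1 1 (by norm_num)).HZ *ᵥ e)
        ((code 4 1 1 (by norm_num)).rowSpX : Set ((Fin 4 → ZMod 2) → ZMod 2)) 1 0 1 :=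
  (secded_optimal (m := 4) le_rfl).1

end QRM

end Literature.InformationTheory.QuantumCodes
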